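import Summits.MatrixMultiplication.MatrixMultiplication.Theorems.SaturationLadderTwinSaturation
import HarnessLib

/-!
# SaturationLadder — the `Y`-inequality of the twin family from `j = 64` on

Support for the crux `SubexpSaturation` (h₁) of `Theses/SaturationLadder.lean` (lens «grading /
quantitative ladder», Kernel XXVI).  `Theorems/SaturationLadderTwinSaturation.lean` proved the
`Y`-entropy inequality `H(Z_j) ≤ H(Y_j)` of the STAGE-2 twin family
(`Theorems/SaturationLadderTwinFamily.lean`: `ω(1, t_j, r_j) = 1 + r_j`, `1 − t_j ≍ 2/j`,
`r_j ≤ 2^{j+1}`) for `j ≥ 1000` with a budget of `0.028` nats against first-order error terms of size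
`O(1/j)`; the `X`-inequality `familyX` holds from `j = 64` on.  Consequently the uniform window
theorem `uniformClause_of_familyY` (`Theorems/SaturationLadderUniformWindowRung.lean`) could only be
instantiated at `j₁ = 1000`, where the family point `(t₁₀₀₀, r₁₀₀₀ ≈ 2^{1001})` is far outside the
reach of any explicit certificate — the uniform rungs `U(log 4 − 1/12800)`, `U(log 4 − 1/20 ∣ V)`
stayed invisible or conditional.

Here the SAME proof is re-run with the sharper budget available at `ε = 1/j ≤ 1/64`:
* `log_five_halves_le_d7`: `log (5/2) ≤ 0.9162908` (ten Taylor terms of `−log(1 − 1/5)`; the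
  four-term bound `0.91662` of the `j ≥ 1000` file loses `8·10⁻⁴`, more than the whole margin);
* `familyY64`: `H(Z_j) ≤ H(Y_j)` for ALL `j ≥ 64` — `d ×` the difference in nats is at least
  `3.35 log 2 − 2.5 log(5/2) − 0.15 ε log 2 − 1.85 ε log(5/2) − 3.369 ε² − 19/2^{j+1} ≥ 0.0023`
  at `ε = 1/64` (true margin `0.0028`; at `ε = 1/60` the linearised budget is already negative, so
  `64`, the threshold of `familyX`, is also essentially the threshold of this argument).
With `familyX` this makes the family point `(t₆₄, r₆₄)`, `t₆₄ = 24832/25441 ≈ 0.97606`,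
`r₆₄ ≈ 2.4·10¹⁹`, an exact value of `ω(1,·,·)` and moves the onset of the `11/10`-clause from
`t₁₀₀₀` to `t₆₄` — within reach of the certified twin table (`Theorems/SaturationLadderTwinTable.lean`),
which is what makes the first visible uniform rung `U(6/5)` possible (next file).

References: D. Coppersmith, S. Winograd, J. Symbolic Comput. 9 (1990) §8 (key
`CoppersmithWinograd1990`); J. Alman, R. Duan, V. Vassilevska Williams, Y. Xu, Z. Xu, R. Zhou, SODA
2025, §3.4 (key `AlmanDuanVassilevskaWilliamsXuXuZhou2025`).
-/

set_option linter.dupNamespace false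
-- (single-conjunct summit: the namespace repeats `MatrixMultiplication`)

noncomputable section

namespace Summit.MatrixMultiplication.MatrixMultiplication.Theorems.SaturationLadderTwinFamilyY64

open Literature.Computability.AlgebraicComplexity
open Summit.MatrixMultiplication.MatrixMultiplication.Theorems.SaturationLadderTwinFamily

/-! ## A seven-digit bound for `log (5/2)` -/

/-- `log (5/2) ≤ 0.9162908` (`log (5/2) = log 2 − log(1 − 1/5)`, ten Taylor terms, remainder
`(1/5)¹¹/(4/5) < 2.6·10⁻⁸`). [folklore] -/
theorem log_five_halves_le_d7 : Real.log (5 / 2) ≤ 0.9162908 := by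
  have h := Real.abs_log_sub_add_sum_range_le (x := (1 / 5 : ℝ))
    (by rw [abs_of_pos (by norm_num)]; norm_num) 10
  rw [abs_le] at h
  have h1 := h.1
  simp only [Finset.sum_range_succ, Finset.sum_range_zero] at h1
  norm_num [abs_of_pos] at h1
  have e : Real.log (5 / 2) = Real.log 2 - Real.log (4 / 5) := by
    rw [← Real.log_div (by norm_num) (by norm_num)]; norm_num
  have hl2 := Real.log_two_lt_d9
  rw [e]; linarith

/-! ## The `Y`-inequality along the family, `j ≥ 64` -/

set_option maxHeartbeats 800000 in
-- (the closing `linarith` calls over a dozen hypotheses with 10-digit constants; measured well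
-- below the limit, the option is kept as in the `j ≥ 1000` original)
/-- **`H(Z_j) ≤ H(Y_j)` for the STAGE-2 family, all `j ≥ 64`** (same statement as `familyY`,
threshold lowered from `1000` to `64`).
[cite: CoppersmithWinograd1990, §8] [cite: AlmanDuanVassilevskaWilliamsXuXuZhou2025, §3.4] -/
theorem familyY64 (j : ℕ) (hj : 64 ≤ j) :
    shannonEntropy
        ![((fN₁ j : ℝ) + fN₄ j + (0 : ℕ)) / (fN₁ j + fN₂ j + fN₃ j + fN₄ j + 0 + fN₆ j : ℕ),
        ((fN₂ j : ℝ) + fN₃ j) / (fN₁ j + fN₂ j + fN₃ j + fN₄ j + 0 + fN₆ j : ℕ),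
        (fN₆ j : ℝ) / (fN₁ j + fN₂ j + fN₃ j + fN₄ j + 0 + fN₆ j : ℕ)] ≤
      shannonEntropy
        ![((fN₃ j : ℝ) + (0 : ℕ) + fN₆ j) / (fN₁ j + fN₂ j + fN₃ j + fN₄ j + 0 + fN₆ j : ℕ),
        ((fN₁ j : ℝ) + fN₂ j) / (fN₁ j + fN₂ j + fN₃ j + fN₄ j + 0 + fN₆ j : ℕ),
        (fN₄ j : ℝ) / (fN₁ j + fN₂ j + fN₃ j + fN₄ j + 0 + fN₆ j : ℕ)] := by
  -- real abbreviations
  have hJ : (64 : ℝ) ≤ (j : ℝ) := by exact_mod_cast hj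
  have hB1 : (2 : ℝ) ^ 65 ≤ (2 : ℝ) ^ (j + 1) := pow_le_pow_right₀ (by norm_num) (by omega)
  have hBpos : (0 : ℝ) < (2 : ℝ) ^ (j + 1) := by positivity
  set B : ℝ := (2 : ℝ) ^ (j + 1) with hBdef
  set d : ℝ := B + 3 with hddef
  have hdpos : 0 < d := by positivity
  have hBd : B ≤ d := by linarith
  have hjpos : (0 : ℝ) < j := by linarith
  -- the counts as reals
  have c₁ : ((fN₁ j : ℕ) : ℝ) = 30 * j + 20 := by unfold fN₁; push_cast; ring
  have c₂ : ((fN₂ j : ℕ) : ℝ) = 20 * j * B - (30 * j + 37) := by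
    rw [fN₂_cast j (by omega)]
  have c₃ : ((fN₃ j : ℕ) : ℝ) = 30 * j + 37 := by unfold fN₃; push_cast; ring
  have c₄ : ((fN₄ j : ℕ) : ℝ) = 10 * j - 20 := fN₄_cast j (by omega)
  have c₆ : ((fN₆ j : ℕ) : ℝ) = 20 * j := by unfold fN₆; push_cast; ring
  have cN : ((fN₁ j + fN₂ j + fN₃ j + fN₄ j + 0 + fN₆ j : ℕ) : ℝ) = 20 * j * d := by
    push_cast; rw [c₁, c₂, c₃, c₄, c₆, hddef]; ring
  -- the small parameter `ε = 1/j` and the `Y`-masses `α, γ, τ = α + γ` (units of `1/d`)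
  set ε : ℝ := 1 / j with hεdef
  have hε0 : 0 ≤ ε := by positivity
  have hεle : ε ≤ 1 / 64 := by
    rw [hεdef, div_le_iff₀ hjpos]; linarith
  have hεJ : ε * j = 1 := by rw [hεdef]; field_simp
  set α : ℝ := 5 / 2 + 37 / 20 * ε with hαdef
  set γ : ℝ := 1 / 2 - ε with hγdef
  set τ : ℝ := 3 + 17 / 20 * ε with hτdef
  have hαpos : 0 < α := by rw [hαdef]; positivity
  have hγpos : 0 < γ := by rw [hγdef]; linarith
  have hd65 : (2 : ℝ) ^ 65 ≤ d := hB1.trans hBd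
  have hτd : τ / d < 1 := by
    rw [div_lt_one hdpos]; linarith [hεle, hd65]
  -- the entries: `Z = (2, B, 1)/d`, `Y = (α/d, 1 − τ/d, γ/d)`
  have eZ0 : ((fN₁ j : ℝ) + fN₄ j + (0 : ℕ)) / (fN₁ j + fN₂ j + fN₃ j + fN₄ j + 0 + fN₆ j : ℕ) =
      2 / d := by
    rw [cN, c₁, c₄]; push_cast; field_simp; ring
  have eZ1 : ((fN₂ j : ℝ) + fN₃ j) / (fN₁ j + fN₂ j + fN₃ j + fN₄ j + 0 + fN₆ j : ℕ) = B / d := by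
    rw [cN, c₂, c₃]; field_simp; ring
  have eZ2 : (fN₆ j : ℝ) / (fN₁ j + fN₂ j + fN₃ j + fN₄ j + 0 + fN₆ j : ℕ) = 1 / d := by
    rw [cN, c₆]; field_simp
  have eY0 : ((fN₃ j : ℝ) + (0 : ℕ) + fN₆ j) / (fN₁ j + fN₂ j + fN₃ j + fN₄ j + 0 + fN₆ j : ℕ) =
      α / d := by
    rw [cN, c₃, c₆, hαdef, hεdef]; push_cast; field_simp; ring
  have eY1 : ((fN₁ j : ℝ) + fN₂ j) / (fN₁ j + fN₂ j + fN₃ j + fN₄ j + 0 + fN₆ j : ℕ) =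
      1 - τ / d := by
    rw [cN, c₁, c₂, hτdef, hεdef]; field_simp; ring
  have eY2 : (fN₄ j : ℝ) / (fN₁ j + fN₂ j + fN₃ j + fN₄ j + 0 + fN₆ j : ℕ) = γ / d := by
    rw [cN, c₄, hγdef, hεdef]; field_simp; ring
  rw [eZ0, eZ1, eZ2, eY0, eY1, eY2]
  -- unfold the entropies (bits → nats)
  have hlog2 : 0 < Real.log 2 := Real.log_pos one_lt_two
  rw [shannonEntropy_def, shannonEntropy_def, div_le_div_iff_of_pos_right hlog2]
  simp only [Fin.sum_univ_three, Matrix.cons_val_zero, Matrix.cons_val_one, Matrix.cons_val_two,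
    Matrix.head_cons, Matrix.tail_cons]
  -- (Z) the left side in closed form and its upper bound (as in `familyX`)
  have hZ : Real.negMulLog (2 / d) + Real.negMulLog (B / d) + Real.negMulLog (1 / d) =
      (Real.log d - Real.log B) + ((3 * (j : ℝ) + 1) * Real.log 2) / d := by
    have hlogB : Real.log B = ((j : ℝ) + 1) * Real.log 2 := by
      rw [hBdef, Real.log_pow]; push_cast; ring
    simp only [Real.negMulLog, Real.log_div two_ne_zero hdpos.ne', Real.log_div hBpos.ne' hdpos.ne',
      Real.log_div one_ne_zero hdpos.ne', Real.log_one]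
    rw [hlogB]
    have : d = B + 3 := hddef
    field_simp
    rw [this]
    ring
  have hZle : Real.negMulLog (2 / d) + Real.negMulLog (B / d) + Real.negMulLog (1 / d) ≤
      3 / B + ((3 * (j : ℝ) + 1) * Real.log 2) / d := by
    rw [hZ]
    have h1 : Real.log d - Real.log B ≤ 3 / B := by
      rw [← Real.log_div hdpos.ne' hBpos.ne']
      have := Real.log_le_sub_one_of_pos (show 0 < d / B by positivity)
      have e : d / B - 1 = 3 / B := by rw [hddef]; field_simp; ring
      linarith
    linarith
  -- (Y) the three terms
  have hY0 : Real.negMulLog (α / d) = α / d * (Real.log d - Real.log α) := by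
    simp only [Real.negMulLog, Real.log_div hαpos.ne' hdpos.ne']; ring
  have hY2 : Real.negMulLog (γ / d) = γ / d * (Real.log d - Real.log γ) := by
    simp only [Real.negMulLog, Real.log_div hγpos.ne' hdpos.ne']; ring
  have hY1 : τ / d - (τ / d) ^ 2 ≤ Real.negMulLog (1 - τ / d) := by
    have h1p : 0 < 1 - τ / d := by linarith
    have hlog : Real.log (1 - τ / d) ≤ -(τ / d) := by
      have := Real.log_le_sub_one_of_pos h1p; linarith
    simp only [Real.negMulLog]
    linear_combination mul_le_mul_of_nonneg_left hlog h1p.le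
  -- logarithm bounds: `log d ≥ (j+1) log 2`, `log α ≤ log (5/2) + (37/50) ε`, `log γ ≤ −log 2 − 2ε`
  have hlogd : ((j : ℝ) + 1) * Real.log 2 ≤ Real.log d := by
    have : Real.log B ≤ Real.log d := Real.log_le_log hBpos hBd
    rw [hBdef, Real.log_pow] at this; push_cast at this; linarith
  have hlogα : Real.log α ≤ Real.log (5 / 2) + 37 / 50 * ε := by
    have h := Real.log_le_sub_one_of_pos (show 0 < α / (5 / 2) by positivity)
    rw [Real.log_div hαpos.ne' (by norm_num)] at h
    rw [hαdef] at h ⊢; linarith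
  have hlogγ : Real.log γ ≤ -Real.log 2 - 2 * ε := by
    have h := Real.log_le_sub_one_of_pos (show 0 < γ / (1 / 2) by positivity)
    rw [Real.log_div hγpos.ne' (by norm_num), Real.log_div one_ne_zero two_ne_zero,
      Real.log_one] at h
    rw [hγdef] at h ⊢; linarith
  have hl2 := Real.log_two_gt_d9
  have hl2' := Real.log_two_lt_d9
  have hP := log_five_halves_le_d7
  have hP0 : 0 ≤ Real.log (5 / 2) := Real.log_nonneg (by norm_num)
  -- the key scaled inequality
  have key : 3 / B + ((3 * (j : ℝ) + 1) * Real.log 2) / d ≤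
      α / d * (Real.log d - Real.log α) + (τ / d - (τ / d) ^ 2) +
        γ / d * (Real.log d - Real.log γ) := by
    have hA : α * (((j : ℝ) + 1) * Real.log 2 - Real.log (5 / 2) - 37 / 50 * ε) ≤
        α * (Real.log d - Real.log α) := mul_le_mul_of_nonneg_left (by linarith) hαpos.le
    have hG : γ * (((j : ℝ) + 1) * Real.log 2 + Real.log 2 + 2 * ε) ≤
        γ * (Real.log d - Real.log γ) := mul_le_mul_of_nonneg_left (by linarith) hγpos.le
    -- expand, using `ε j = 1`
    have hexp : α * (((j : ℝ) + 1) * Real.log 2 - Real.log (5 / 2) - 37 / 50 * ε) +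
        γ * (((j : ℝ) + 1) * Real.log 2 + Real.log 2 + 2 * ε) =
        3 * ((j : ℝ) + 1) * Real.log 2 + 27 / 20 * Real.log 2 - 5 / 2 * Real.log (5 / 2) -
          17 / 20 * ε - 3 / 20 * (ε * Real.log 2) - 37 / 20 * (ε * Real.log (5 / 2)) -
          3369 / 1000 * ε ^ 2 := by
      rw [hαdef, hγdef]
      linear_combination (37 / 20 * Real.log 2 - Real.log 2) * hεJ
    -- numeric bounds on the small products
    have hεL : ε * Real.log 2 ≤ 0.010830425 := by
      have := mul_le_mul hεle hl2'.le hlog2.le (by norm_num); linarith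
    have hεP : ε * Real.log (5 / 2) ≤ 0.01431704375 := by
      have := mul_le_mul hεle hP hP0 (by norm_num); linarith
    have hε2 : ε ^ 2 ≤ 0.000244140625 := by
      have := pow_le_pow_left₀ hε0 hεle 2; norm_num at this; linarith
    have hB19 : 19 / B ≤ 0.000000001 := by
      rw [div_le_iff₀ hBpos]; norm_num at hB1 ⊢; linarith
    have h19 : 9 / B + 10 / B = 19 / B := by ring
    have hτ2 : τ ^ 2 ≤ 10 := by rw [hτdef]; nlinarith [hεle, hε0]
    have h3dB : 3 * d / B = 3 + 9 / B := by
      rw [hddef]; field_simp; ring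
    have hτdB : τ ^ 2 / d ≤ 10 / B := by
      calc τ ^ 2 / d ≤ 10 / d := div_le_div_of_nonneg_right hτ2 hdpos.le
        _ ≤ 10 / B := div_le_div_of_nonneg_left (by norm_num) hBpos hBd
    have hτε : τ = 3 + 17 / 20 * ε := hτdef
    -- the goal multiplied by `d`
    have hscaled : 3 * d / B + (3 * (j : ℝ) + 1) * Real.log 2 ≤
        α * (Real.log d - Real.log α) + τ - τ ^ 2 / d + γ * (Real.log d - Real.log γ) := by
      rw [h3dB]
      linarith [hA, hG, hexp, hεL, hεP, hε2, hB19, h19, hτdB, hl2, hP, hτε]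
    have hdiv := div_le_div_of_nonneg_right hscaled hdpos.le
    have e1 : 3 / B + ((3 * (j : ℝ) + 1) * Real.log 2) / d =
        (3 * d / B + (3 * (j : ℝ) + 1) * Real.log 2) / d := by
      field_simp
    have e2 : α / d * (Real.log d - Real.log α) + (τ / d - (τ / d) ^ 2) +
        γ / d * (Real.log d - Real.log γ) =
        (α * (Real.log d - Real.log α) + τ - τ ^ 2 / d + γ * (Real.log d - Real.log γ)) / d := by
      field_simp; ring
    rw [e1, e2]; exact hdiv
  linarith [hZle, hY0, hY1, hY2, key]

end Summit.MatrixMultiplication.MatrixMultiplication.Theorems.SaturationLadderTwinFamilyY64
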